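import Summits.HodgeConjecture.HodgeConjecture.Theses.AnchorTransport
import Summits.HodgeConjecture.HodgeConjecture.Theorems.AnchorTransportTargetIffHodgeConjecture

/-!
# `VariationalHodge` (stmt-HodgeConjecture-1076) · Negative · the crux is dominated by the Hodge conjecture, and its anchor carries all of its content

Negative-side knowledge for the crux `AnchorTransport.VariationalHodge` (Grothendieck's variational
Hodge conjecture in global-class form: `f : 𝒳 ⟶ S` a smooth projective family over a smooth
irreducible base, `A ∈ H²ᵖ(𝒳(ℂ); ℂ)` fibrewise rational of type `(p,p)`, algebraic on one fibre ⇒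
algebraic on every fibre), extracted from the standing disprover's work file
`Cruxes/VariationalHodge/Disproof.lean` §1–§2 (refuter-cdisprove-stmt-HodgeConjecture-1076-0, cycle 1,
2026-08-16). Everything unconditional and `sorry`-free; no statement of the route is asserted.

* `not_hodgeConjecture_of_not_variationalHodge` : `¬ crux → ¬ HodgeConjecture` — the summit gives the
  crux fibrewise (`anchorTransport_variationalHodge_of_hodgeConjecture`, base hypotheses and anchor
  unused; Charles–Schnell Cor. 11.3.6), so ANY kill of the crux is a counterexample to the Clay
  problem as typed.
* `exists_jumpingPair_of_not_variationalHodge` : SHARP FORM of a kill — a smooth projective family over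
  a smooth irreducible base and ONE global class, fibrewise rational `(p,p)`, algebraic on the fibre at
  `s₀` and NOT algebraic on the fibre at `s₁` (a Noether–Lefschetz-type jumping pair for algebraicity
  inside one algebraic family); `exists_nonalgebraic_hodgeClass_of_not_variationalHodge` : the fibre at
  `s₁` is then a smooth projective variety carrying a non-algebraic Hodge class.
* `hodgeConjecture_iff_variationalHodge_withoutAnchor` : LOAD-BEARING CERTIFICATE for the anchor
  hypothesis `∃ s₀, A|_{𝒳_{s₀}} ∈ algebraicClasses`: the crux with the anchor deleted is equivalent to
  `HodgeConjecture` itself (constant family `X ⟶ Spec ℂ`, whose fibre inclusions are isomorphisms).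
  "Any proof must use the anchor" thus holds in the strongest sense, and the anchor-free strengthening
  is exactly as unrefutable as the summit.
* `not_hodgeConjecture_of_not_variationalHodge_anyBase` : the crux with the base hypotheses
  (`IrreducibleSpace`, `Smooth`) deleted is still HC-implied — irreducibility and smoothness of the base
  are load-bearing for the transport MECHANISM only, never for the truth value.
-/

noncomputable section

set_option linter.dupNamespace false

namespace Summit.HodgeConjecture.HodgeConjecture.Theorems.VariationalHodge.Negative

open CategoryTheory AlgebraicGeometry
open Literature.AlgebraicGeometry.Motives Literature.AlgebraicGeometry.HodgeTheory
open Summit.HodgeConjecture.HodgeConjecture.Theses.AnchorTransport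
open Summit.HodgeConjecture.HodgeConjecture.Theorems

/-- **A kill of the crux is a disproof of the Hodge conjecture**:
`HodgeConjecture → VariationalHodge` (fibrewise), contraposed.
[cite: CharlesSchnell2014Notes, Cor. 11.3.6] -/
theorem not_hodgeConjecture_of_not_variationalHodge (h : ¬ VariationalHodge) :
    ¬ _root_.HodgeConjecture :=
  fun hHC => h (anchorTransport_variationalHodge_of_hodgeConjecture hHC)

/-- **Sharp form of a kill: a jumping pair for algebraicity inside one family.** If the crux fails,
there are a smooth projective family `f : 𝒳 ⟶ S` over a smooth irreducible base, a degree `p`, a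
global class `A ∈ H²ᵖ(𝒳(ℂ); ℂ)` all of whose fibre restrictions are rational of type `(p,p)`, and two
complex points `s₀, s₁` with `A|_{𝒳_{s₀}}` algebraic and `A|_{𝒳_{s₁}}` NOT algebraic. [folklore] -/
theorem exists_jumpingPair_of_not_variationalHodge (h : ¬ VariationalHodge) :
    ∃ (n : ℕ) (𝒳 S : SchemeOver ℂ) (f : 𝒳 ⟶ S) (p : ℕ) (A : complexBetti 𝒳 (2 * p))
      (s₀ s₁ : ComplexPoints S),
      IsSmoothProjectiveFamily f n ∧ IrreducibleSpace S.left ∧ AlgebraicGeometry.Smooth S.hom ∧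
      (∀ s : ComplexPoints S, IsRationalClass (complexBetti.map (fiberι f s) (2 * p) A) ∧
        IsOfHodgeType n (fiberOver f s) (2 * p) p p (complexBetti.map (fiberι f s) (2 * p) A)) ∧
      complexBetti.map (fiberι f s₀) (2 * p) A ∈ algebraicClasses (fiberOver f s₀) p ∧
      complexBetti.map (fiberι f s₁) (2 * p) A ∉ algebraicClasses (fiberOver f s₁) p := by
  by_contra hno
  refine h fun n 𝒳 S f hf hirr hsm p A hA hs₀ s => ?_
  obtain ⟨s₀, hs₀⟩ := hs₀
  by_contra hs
  exact hno ⟨n, 𝒳, S, f, p, A, s₀, s, hf, hirr, hsm, hA, hs₀, hs⟩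

/-- **A kill exhibits a non-algebraic Hodge class on a smooth projective variety** (the fibre at the
jumping point): the counterexample to the Clay problem hidden in any refutation of the crux, on the
nose and without any transport. [folklore] -/
theorem exists_nonalgebraic_hodgeClass_of_not_variationalHodge (h : ¬ VariationalHodge) :
    ∃ (n : ℕ) (X : SchemeOver ℂ), IsSmoothProjective n X ∧
      ∃ (p : ℕ) (c : complexBetti X (2 * p)),
        IsRationalClass c ∧ IsOfHodgeType n X (2 * p) p p c ∧ c ∉ algebraicClasses X p := by
  obtain ⟨n, 𝒳, S, f, p, A, _, s₁, hf, _, _, hA, _, hs₁⟩ := exists_jumpingPair_of_not_variationalHodge h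
  exact ⟨n, fiberOver f s₁, hf.isSmoothProjective s₁, p, _, (hA s₁).1, (hA s₁).2, hs₁⟩

/-- **Load-bearing certificate for the anchor.** The crux with its anchor hypothesis
`∃ s₀, A|_{𝒳_{s₀}} ∈ algebraicClasses` DELETED — "every fibrewise rational `(p,p)` global class on a
smooth projective family over a smooth irreducible base is fibrewise algebraic" — is equivalent to the
Hodge conjecture: (⇐) fibrewise; (⇒) read a rational `(p,p)` class `c` on a smooth projective `X` as a
global class on the constant family `X ⟶ Spec ℂ` (a smooth projective family over the smooth
irreducible `Spec ℂ`, every fibre inclusion an isomorphism along which rationality and Hodge type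
transport: `IsRationalClass.pullback`, `IsOfHodgeType.map_of_iso`), conclude on the fibre at `𝟙`, and
carry algebraicity back along the inverse isomorphism (`mem_algebraicClasses_map_of_iso`). So no
`_false_without_anchor` witness exists short of `¬ HodgeConjecture`, and conversely any proof of the
crux that does not use the anchor proves the summit. [folklore] -/
theorem hodgeConjecture_iff_variationalHodge_withoutAnchor :
    _root_.HodgeConjecture ↔
    ∀ ⦃n : ℕ⦄ ⦃𝒳 S : SchemeOver ℂ⦄ (f : 𝒳 ⟶ S), IsSmoothProjectiveFamily f n →
      IrreducibleSpace S.left → AlgebraicGeometry.Smooth S.hom →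
      ∀ (p : ℕ) (A : complexBetti 𝒳 (2 * p)),
      (∀ s : ComplexPoints S, IsRationalClass (complexBetti.map (fiberι f s) (2 * p) A) ∧
        IsOfHodgeType n (fiberOver f s) (2 * p) p p (complexBetti.map (fiberι f s) (2 * p) A)) →
      ∀ s : ComplexPoints S,
        complexBetti.map (fiberι f s) (2 * p) A ∈ algebraicClasses (fiberOver f s) p := by
  refine ⟨fun h _ _ _ _ hf _ _ p _ hA s => (h (hf.isSmoothProjective s)).2 p _ (hA s).1 (hA s).2,
    fun h n X hX => ?_⟩
  refine (hodgeConjectureFor_iff_of_isSmoothProjective nonempty_hodgeModel_holds hX).2 ?_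
  intro p c hc hpp
  haveI : ∀ s : AlgPoints (specOver ℂ ℂ) ℂ, IsIso (fiberι (toSpecOver X) s) := isIso_fiberι_toSpecOver
  have hfam : IsSmoothProjectiveFamily (toSpecOver X) n := isSmoothProjectiveFamily_toSpecOver hX
  -- the anchor-free statement on the constant family, at the point `𝟙 (Spec ℂ)`
  have key := h (toSpecOver X) hfam irreducibleSpace_specOver_left smooth_specOver_hom p c
    (fun s => ⟨hc.pullback _, IsOfHodgeType.map_of_iso (asIso (fiberι (toSpecOver X) s)) hpp⟩) (𝟙 _)
  -- back along the inverse of the fibre isomorphism `X_{𝟙} ≅ X`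
  have back := mem_algebraicClasses_map_of_iso (hfam.isSmoothProjective (𝟙 _)) hX
    (asIso (fiberι (toSpecOver X) (𝟙 _))).symm key
  have hid : complexBetti.map (asIso (fiberι (toSpecOver X) (𝟙 _))).symm.hom (2 * p)
      (complexBetti.map (fiberι (toSpecOver X) (𝟙 _)) (2 * p) c) = c := by
    change (complexBetti.map (asIso (fiberι (toSpecOver X) (𝟙 _))).hom (2 * p) ≫
      complexBetti.map (asIso (fiberι (toSpecOver X) (𝟙 _))).inv (2 * p)) c = c
    rw [← complexBetti.map_comp, Iso.inv_hom_id, complexBetti.map_id]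
    rfl
  rwa [hid] at back

/-- **The base hypotheses are not load-bearing for the truth value**: the crux with
`IrreducibleSpace S.left` and `Smooth S.hom` deleted (arbitrary base scheme: reducible, singular,
non-separated, …) is still implied by the Hodge conjecture, fibrewise — contraposed: a kill of even that
strengthening disproves the summit. Irreducibility (= connectedness, for a smooth base) is what the
transport MECHANISM needs, not what the truth value needs. [folklore] -/
theorem not_hodgeConjecture_of_not_variationalHodge_anyBase
    (h : ¬ ∀ ⦃n : ℕ⦄ ⦃𝒳 S : SchemeOver ℂ⦄ (f : 𝒳 ⟶ S), IsSmoothProjectiveFamily f n →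
      ∀ (p : ℕ) (A : complexBetti 𝒳 (2 * p)),
      (∀ s : ComplexPoints S, IsRationalClass (complexBetti.map (fiberι f s) (2 * p) A) ∧
        IsOfHodgeType n (fiberOver f s) (2 * p) p p (complexBetti.map (fiberι f s) (2 * p) A)) →
      (∃ s₀ : ComplexPoints S,
        complexBetti.map (fiberι f s₀) (2 * p) A ∈ algebraicClasses (fiberOver f s₀) p) →
      ∀ s : ComplexPoints S,
        complexBetti.map (fiberι f s) (2 * p) A ∈ algebraicClasses (fiberOver f s) p) :
    ¬ _root_.HodgeConjecture :=
  fun hHC => h fun _ _ _ _ hf p _ hA _ s => (hHC (hf.isSmoothProjective s)).2 p _ (hA s).1 (hA s).2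

end Summit.HodgeConjecture.HodgeConjecture.Theorems.VariationalHodge.Negative

end
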